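import Summits.HodgeConjecture.HodgeConjecture.Theorems.F0P2dSocketDOfStubs
import Summits.HodgeConjecture.HodgeConjecture.Theorems.P2H413OfSocketsCD
import Literature.NumberTheory.Automorphic.UnitaryGroupHolCotFormsReproducing
import Summits.HodgeConjecture.HodgeConjecture.Theorems.F0P2dStubSCotFormL2Data
import Summits.HodgeConjecture.HodgeConjecture.Theorems.F0P2dStubR
import HarnessLib

/-!
# Crux `H413`, (D) desk — THE SUCCESSOR: `CotangentForms.holCotFormSpectralProjection` with the sub-line's stubs DISCHARGED BY NAME as they land
# (append-only file; v1: (K) discharged — ★ p797711 `CotangentForms.stubK_reproducingKernel_holds`, p03 (g2); v2: (S) discharged — ★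
# `F0P2dStubSCotFormL2Data.stubSCotFormL2Data_holds`, A-p18 (g16); v3: (R) discharged — ★ `F0P2dStubR.stubR_holds`, F0P2-p04 (g2):
# `holCotFormSpectralProjection_holds : CotangentForms.holCotFormSpectralProjection` — THE (D) SOCKET, UNCONDITIONAL, BY NAME)

Cell hodgecm-mathlib (D-0151), FLOOR 0, crux item H413 = stmt-HodgeConjecture-24833; programme P2; sub-line `Cruxes/H413/Lines/F0_P2SpectralProjectionD.lean`
(v1.2 of record, registrar A-plan1 (g18); sorries {K, S, R} → v1.3 folds K).  Author F0P2-p01 (g2).  THEOREMS ONLY; `--supports stmt-HodgeConjecture-24833 --as helper`.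
HC_CM is proved only modulo the 7 printed citations until rung 0 closes; this file proves nothing about them.

Over the Theorems-level assembly ★ `F0P2dSocketDOfStubs.holCotFormSpectralProjection_of_KSR (hK) (hS) (hR)` (p797808: ★ H, T, G consumed by name) this file
discharges the remaining hypotheses one by one, BY NAME, as the closers land — v1: `hK :=` ★ `CotangentForms.stubK_reproducingKernel_holds` (p797711; the
registered (K) body with `IsRegularKernel` as the conjunction of its four fields and `IsReproducedAlong` unfolded — literally the assembly's `hK`).  The census
after v1 is {S (A-p18 (g16)), R (F0P2-p04 (g2))}; v2 appends `…_of_R` when (S) is ★, v3 appends `holCotFormSpectralProjection_holds : holCotFormSpectralProjection`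
when (R) is ★ (previous declarations byte-identical — append protocol).  The crux-level reading goes through the (C′)-free head ★ `P2H413OfSocketsCD.H413_of_sockets_CD`.

* `holCotFormSpectralProjection_of_SR (hS) (hR) : holCotFormSpectralProjection`;
* `H413_of_SR_CU4 (hS) (hR) (hC) (hU4) (hJ3a) (hocc) : HCCMUnconditional.H413`.

## References
* [BorelJacquet1979] §4.2, §4.6.  [Borel1997] Thm. 2.13, §5.14, §8.4.  [HarishChandra1966] §8 Thm. 1.  [Liu2021] Prop. 4.13, Rem. 4.14.  [Rogawski1990] Thm. 13.3.1.
-/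

set_option autoImplicit false

-- the mandated namespace has the single-problem summit's repeated segment (`HodgeConjecture.HodgeConjecture`)
set_option linter.dupNamespace false

noncomputable section

namespace Summit.HodgeConjecture.HodgeConjecture.Cruxes.H413.F0P2dSocketD

open scoped Matrix ComplexOrder ContDiff
open MeasureTheory NumberField MulAction
open Literature.NumberTheory.Automorphic Literature.NumberTheory.Automorphic.UnitaryGroup
open Literature.NumberTheory.Automorphic.UnitaryGroup.CotangentForms
open Literature.AlgebraicGeometry.ShimuraVarieties
open Literature.Geometry.ComplexHyperbolic.BallModel (U21 x₀)
open Summit.HodgeConjecture.HodgeConjecture.Cruxes.H413.SpectrumInterfaces (StubU4SignRule HJ3aType HoccType HdictEType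
  StubU2CohFormsSpectrumIsThetaAt)

/-- **(D) from (S) and (R)** — (K) discharged by ★ `CotangentForms.stubK_reproducingKernel_holds` (p03 (g2), p797711: the matrix reproducing kernel
`A(u) = κ β(‖u·x₀‖²) • coT u x₀` on `U(2,1)`, radial mean value on `𝔹²`), over ★ `F0P2dSocketDOfStubs.holCotFormSpectralProjection_of_KSR`.
[cite: Borel1997, Thm. 2.13 and §5.14] [cite: HarishChandra1966, §8, Thm. 1] [cite: BorelJacquet1979, §4.6] -/
theorem holCotFormSpectralProjection_of_SR
    (hS : ∀ (L : Type) [Field L] [NumberField L] [IsCMField L] (ι : L →+* ℂ) (H : Matrix (Fin 3) (Fin 3) L) (T : GL (Fin 3) ℂ)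
      (hT : (T : Matrix (Fin 3) (Fin 3) ℂ)ᴴ * H.map ι * (T : Matrix (Fin 3) (Fin 3) ℂ) = Literature.Geometry.ComplexHyperbolic.BallModel.J),
      (∀ τ' : L →+* ℂ, InfinitePlace.mk τ' ≠ InfinitePlace.mk ι → (H.map τ').PosDef) →
      2 ≤ Module.finrank ℚ ↥(maximalRealSubfield L) →
      ∀ (μ : Measure (adelicGroupData (↥(maximalRealSubfield L)) L (IsCMField.complexConj L) 3 H).automorphicQuotient)
        [(adelicGroupData (↥(maximalRealSubfield L)) L (IsCMField.complexConj L) 3 H).IsAutomorphicMeasure μ]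
        (ν : Measure ↥U21) [ν.IsHaarMeasure] (A : ↥U21 → Matrix (Fin 2) (Fin 2) ℂ),
        (Continuous A ∧ HasCompactSupport A ∧
          (∀ (j i : Fin 2) (u' : ↥U21), ContDiff ℝ 1 fun b : Fin 2 → ℂ => A (BallForms.expP b * u') j i) ∧
          ∀ j i : Fin 2, Continuous fun p : (Fin 2 → ℂ) × ↥U21 => fderiv ℝ (fun b : Fin 2 → ℂ => A (BallForms.expP b * p.2) j i) p.1) →
        (∀ Φ : (adelicGroupData (↥(maximalRealSubfield L)) L (IsCMField.complexConj L) 3 H).Adelic → (Fin 2 → ℂ),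
          (∀ (k : stabilizer (↥U21) x₀) (g : (adelicGroupData (↥(maximalRealSubfield L)) L (IsCMField.complexConj L) 3 H).Adelic),
            Φ (g * cmArchSection L ι H T hT k) = BallForms.isPullbackCocycle_cotangentCocycle.weightOf x₀ k⁻¹ (Φ g)) →
          IsHolGerm (cmArchSection L ι H T hT) Φ →
            ∀ y : (adelicGroupData (↥(maximalRealSubfield L)) L (IsCMField.complexConj L) 3 H).Adelic, ∫ u, A u *ᵥ Φ (y * cmArchSection L ι H T hT u) ∂ν = Φ y) →
      ∀ (Φ : (adelicGroupData (↥(maximalRealSubfield L)) L (IsCMField.complexConj L) 3 H).Adelic → (Fin 2 → ℂ)), Φ ∈ holCotForms (↥(maximalRealSubfield L)) L (IsCMField.complexConj L) 3 H (cmArchSection L ι H T hT) (cmCompactFactor L ι H T hT) →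
      ∀ hΦ : ∀ j : Fin 2, MemLp (toQuotFun (adelicGroupData (↥(maximalRealSubfield L)) L (IsCMField.complexConj L) 3 H) fun g => Φ g j) 2 μ,
        (∀ j, (∑ i : Fin 2, ∫ t, A t j i • (adelicGroupData (↥(maximalRealSubfield L)) L (IsCMField.complexConj L) 3 H).rightRegular μ (cmArchSection L ι H T hT t) (MemLp.toLp (toQuotFun (adelicGroupData (↥(maximalRealSubfield L)) L (IsCMField.complexConj L) 3 H) fun g => Φ g i) (hΦ i)) ∂ν) = (MemLp.toLp (toQuotFun (adelicGroupData (↥(maximalRealSubfield L)) L (IsCMField.complexConj L) 3 H) fun g => Φ g j) (hΦ j))) ∧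
        (∀ k ∈ cmCompactFactor L ι H T hT, ∀ j, (adelicGroupData (↥(maximalRealSubfield L)) L (IsCMField.complexConj L) 3 H).rightRegular μ k (MemLp.toLp (toQuotFun (adelicGroupData (↥(maximalRealSubfield L)) L (IsCMField.complexConj L) 3 H) fun g => Φ g j) (hΦ j)) = (MemLp.toLp (toQuotFun (adelicGroupData (↥(maximalRealSubfield L)) L (IsCMField.complexConj L) 3 H) fun g => Φ g j) (hΦ j))) ∧
        (∃ Kf : Subgroup (finAdelic (↥(maximalRealSubfield L)) L (IsCMField.complexConj L) 3 H), IsOpen (Kf : Set (finAdelic (↥(maximalRealSubfield L)) L (IsCMField.complexConj L) 3 H)) ∧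
          ∀ k ∈ Kf, ∀ j, (adelicGroupData (↥(maximalRealSubfield L)) L (IsCMField.complexConj L) 3 H).rightRegular μ (finAdelicToAdelic (↥(maximalRealSubfield L)) L (IsCMField.complexConj L) 3 H k) (MemLp.toLp (toQuotFun (adelicGroupData (↥(maximalRealSubfield L)) L (IsCMField.complexConj L) 3 H) fun g => Φ g j) (hΦ j)) = (MemLp.toLp (toQuotFun (adelicGroupData (↥(maximalRealSubfield L)) L (IsCMField.complexConj L) 3 H) fun g => Φ g j) (hΦ j))) ∧
        (∀ (k : stabilizer (↥U21) x₀) (j : Fin 2), (adelicGroupData (↥(maximalRealSubfield L)) L (IsCMField.complexConj L) 3 H).rightRegular μ (cmArchSection L ι H T hT k) (MemLp.toLp (toQuotFun (adelicGroupData (↥(maximalRealSubfield L)) L (IsCMField.complexConj L) 3 H) fun g => Φ g j) (hΦ j)) =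
          ∑ i : Fin 2, (BallForms.isPullbackCocycle_cotangentCocycle.weightOf x₀ k⁻¹ (Pi.single i 1)) j • (MemLp.toLp (toQuotFun (adelicGroupData (↥(maximalRealSubfield L)) L (IsCMField.complexConj L) 3 H) fun g => Φ g i) (hΦ i))) ∧
        (∀ j, DifferentiableAt ℝ (fun b : Fin 2 → ℂ => (adelicGroupData (↥(maximalRealSubfield L)) L (IsCMField.complexConj L) 3 H).rightRegular μ (cmArchSection L ι H T hT (BallForms.expP b)) (MemLp.toLp (toQuotFun (adelicGroupData (↥(maximalRealSubfield L)) L (IsCMField.complexConj L) 3 H) fun g => Φ g j) (hΦ j))) 0) ∧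
        (∀ j, ∀ b : Fin 2 → ℂ,
          fderiv ℝ (fun b : Fin 2 → ℂ => (adelicGroupData (↥(maximalRealSubfield L)) L (IsCMField.complexConj L) 3 H).rightRegular μ (cmArchSection L ι H T hT (BallForms.expP b)) (MemLp.toLp (toQuotFun (adelicGroupData (↥(maximalRealSubfield L)) L (IsCMField.complexConj L) 3 H) fun g => Φ g j) (hΦ j))) 0 (Complex.I • b) =
            Complex.I • fderiv ℝ (fun b : Fin 2 → ℂ => (adelicGroupData (↥(maximalRealSubfield L)) L (IsCMField.complexConj L) 3 H).rightRegular μ (cmArchSection L ι H T hT (BallForms.expP b)) (MemLp.toLp (toQuotFun (adelicGroupData (↥(maximalRealSubfield L)) L (IsCMField.complexConj L) 3 H) fun g => Φ g j) (hΦ j))) 0 b))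
    (hR : ∀ (L : Type) [Field L] [NumberField L] [IsCMField L] (ι : L →+* ℂ) (H : Matrix (Fin 3) (Fin 3) L) (T : GL (Fin 3) ℂ)
      (hT : (T : Matrix (Fin 3) (Fin 3) ℂ)ᴴ * H.map ι * (T : Matrix (Fin 3) (Fin 3) ℂ) = Literature.Geometry.ComplexHyperbolic.BallModel.J),
      (∀ τ' : L →+* ℂ, InfinitePlace.mk τ' ≠ InfinitePlace.mk ι → (H.map τ').PosDef) →
      2 ≤ Module.finrank ℚ ↥(maximalRealSubfield L) →
      ∀ (μ : Measure (adelicGroupData (↥(maximalRealSubfield L)) L (IsCMField.complexConj L) 3 H).automorphicQuotient)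
        [(adelicGroupData (↥(maximalRealSubfield L)) L (IsCMField.complexConj L) 3 H).IsAutomorphicMeasure μ]
        (ν : Measure ↥U21) [ν.IsHaarMeasure] (A : ↥U21 → Matrix (Fin 2) (Fin 2) ℂ),
        (Continuous A ∧ HasCompactSupport A ∧
          (∀ (j i : Fin 2) (u' : ↥U21), ContDiff ℝ 1 fun b : Fin 2 → ℂ => A (BallForms.expP b * u') j i) ∧
          ∀ j i : Fin 2, Continuous fun p : (Fin 2 → ℂ) × ↥U21 => fderiv ℝ (fun b : Fin 2 → ℂ => A (BallForms.expP b * p.2) j i) p.1) →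
      ∀ (w : Fin 2 → (adelicGroupData (↥(maximalRealSubfield L)) L (IsCMField.complexConj L) 3 H).L2 μ),
        (∀ j, (∑ i : Fin 2, ∫ t, A t j i • (adelicGroupData (↥(maximalRealSubfield L)) L (IsCMField.complexConj L) 3 H).rightRegular μ (cmArchSection L ι H T hT t) (w i) ∂ν) = w j) →
        (∀ k ∈ cmCompactFactor L ι H T hT, ∀ j, (adelicGroupData (↥(maximalRealSubfield L)) L (IsCMField.complexConj L) 3 H).rightRegular μ k (w j) = w j) →
        (∃ Kf : Subgroup (finAdelic (↥(maximalRealSubfield L)) L (IsCMField.complexConj L) 3 H), IsOpen (Kf : Set (finAdelic (↥(maximalRealSubfield L)) L (IsCMField.complexConj L) 3 H)) ∧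
          ∀ k ∈ Kf, ∀ j, (adelicGroupData (↥(maximalRealSubfield L)) L (IsCMField.complexConj L) 3 H).rightRegular μ (finAdelicToAdelic (↥(maximalRealSubfield L)) L (IsCMField.complexConj L) 3 H k) (w j) = w j) →
        ∃ Ψ : Fin 2 → ((adelicGroupData (↥(maximalRealSubfield L)) L (IsCMField.complexConj L) 3 H).Adelic → ℂ), ∀ j,
          (∀ γ ∈ (adelicGroupData (↥(maximalRealSubfield L)) L (IsCMField.complexConj L) 3 H).quotientSubgroup, ∀ x, Ψ j (γ * x) = Ψ j x) ∧
            Continuous (Ψ j) ∧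
            toQuotFun (adelicGroupData (↥(maximalRealSubfield L)) L (IsCMField.complexConj L) 3 H) (Ψ j) =ᵐ[μ] (w j : (adelicGroupData (↥(maximalRealSubfield L)) L (IsCMField.complexConj L) 3 H).automorphicQuotient → ℂ) ∧
            (∀ y, DifferentiableAt ℝ (fun b : Fin 2 → ℂ => Ψ j (y * cmArchSection L ι H T hT (BallForms.expP b))) 0) ∧
            (∀ b : Fin 2 → ℂ, Continuous fun y => fderiv ℝ (fun b : Fin 2 → ℂ => Ψ j (y * cmArchSection L ι H T hT (BallForms.expP b))) 0 b) ∧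
            ∀ b : Fin 2 → ℂ,
              toQuotFun (adelicGroupData (↥(maximalRealSubfield L)) L (IsCMField.complexConj L) 3 H) (fun y => fderiv ℝ (fun b : Fin 2 → ℂ => Ψ j (y * cmArchSection L ι H T hT (BallForms.expP b))) 0 b) =ᵐ[μ]
                ((fderiv ℝ (fun b : Fin 2 → ℂ => (adelicGroupData (↥(maximalRealSubfield L)) L (IsCMField.complexConj L) 3 H).rightRegular μ (cmArchSection L ι H T hT (BallForms.expP b)) (w j)) 0 b : (adelicGroupData (↥(maximalRealSubfield L)) L (IsCMField.complexConj L) 3 H).L2 μ) :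
                  (adelicGroupData (↥(maximalRealSubfield L)) L (IsCMField.complexConj L) 3 H).automorphicQuotient → ℂ))
    : holCotFormSpectralProjection :=
  F0P2dSocketDOfStubs.holCotFormSpectralProjection_of_KSR stubK_reproducingKernel_holds hS hR

set_option synthInstance.maxHeartbeats 400000 in
set_option maxHeartbeats 8000000 in
/-- **THE CRUX BY NAME from (S), (R), the engine letter (C), the sign rule U4 and the rows `hJ3a`, `hocc`** ((K) ★, (C′) and (D̄) gone): ★
`P2H413OfSocketsCD.H413_of_sockets_CD` at (D) := `holCotFormSpectralProjection_of_SR hS hR`. [cite: Liu2021, Prop. 4.13 and Rem. 4.14] [cite: Rogawski1990, Thm. 13.3.1] -/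
theorem H413_of_SR_CU4
    (hS : ∀ (L : Type) [Field L] [NumberField L] [IsCMField L] (ι : L →+* ℂ) (H : Matrix (Fin 3) (Fin 3) L) (T : GL (Fin 3) ℂ)
      (hT : (T : Matrix (Fin 3) (Fin 3) ℂ)ᴴ * H.map ι * (T : Matrix (Fin 3) (Fin 3) ℂ) = Literature.Geometry.ComplexHyperbolic.BallModel.J),
      (∀ τ' : L →+* ℂ, InfinitePlace.mk τ' ≠ InfinitePlace.mk ι → (H.map τ').PosDef) →
      2 ≤ Module.finrank ℚ ↥(maximalRealSubfield L) →
      ∀ (μ : Measure (adelicGroupData (↥(maximalRealSubfield L)) L (IsCMField.complexConj L) 3 H).automorphicQuotient)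
        [(adelicGroupData (↥(maximalRealSubfield L)) L (IsCMField.complexConj L) 3 H).IsAutomorphicMeasure μ]
        (ν : Measure ↥U21) [ν.IsHaarMeasure] (A : ↥U21 → Matrix (Fin 2) (Fin 2) ℂ),
        (Continuous A ∧ HasCompactSupport A ∧
          (∀ (j i : Fin 2) (u' : ↥U21), ContDiff ℝ 1 fun b : Fin 2 → ℂ => A (BallForms.expP b * u') j i) ∧
          ∀ j i : Fin 2, Continuous fun p : (Fin 2 → ℂ) × ↥U21 => fderiv ℝ (fun b : Fin 2 → ℂ => A (BallForms.expP b * p.2) j i) p.1) →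
        (∀ Φ : (adelicGroupData (↥(maximalRealSubfield L)) L (IsCMField.complexConj L) 3 H).Adelic → (Fin 2 → ℂ),
          (∀ (k : stabilizer (↥U21) x₀) (g : (adelicGroupData (↥(maximalRealSubfield L)) L (IsCMField.complexConj L) 3 H).Adelic),
            Φ (g * cmArchSection L ι H T hT k) = BallForms.isPullbackCocycle_cotangentCocycle.weightOf x₀ k⁻¹ (Φ g)) →
          IsHolGerm (cmArchSection L ι H T hT) Φ →
            ∀ y : (adelicGroupData (↥(maximalRealSubfield L)) L (IsCMField.complexConj L) 3 H).Adelic, ∫ u, A u *ᵥ Φ (y * cmArchSection L ι H T hT u) ∂ν = Φ y) →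
      ∀ (Φ : (adelicGroupData (↥(maximalRealSubfield L)) L (IsCMField.complexConj L) 3 H).Adelic → (Fin 2 → ℂ)), Φ ∈ holCotForms (↥(maximalRealSubfield L)) L (IsCMField.complexConj L) 3 H (cmArchSection L ι H T hT) (cmCompactFactor L ι H T hT) →
      ∀ hΦ : ∀ j : Fin 2, MemLp (toQuotFun (adelicGroupData (↥(maximalRealSubfield L)) L (IsCMField.complexConj L) 3 H) fun g => Φ g j) 2 μ,
        (∀ j, (∑ i : Fin 2, ∫ t, A t j i • (adelicGroupData (↥(maximalRealSubfield L)) L (IsCMField.complexConj L) 3 H).rightRegular μ (cmArchSection L ι H T hT t) (MemLp.toLp (toQuotFun (adelicGroupData (↥(maximalRealSubfield L)) L (IsCMField.complexConj L) 3 H) fun g => Φ g i) (hΦ i)) ∂ν) = (MemLp.toLp (toQuotFun (adelicGroupData (↥(maximalRealSubfield L)) L (IsCMField.complexConj L) 3 H) fun g => Φ g j) (hΦ j))) ∧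
        (∀ k ∈ cmCompactFactor L ι H T hT, ∀ j, (adelicGroupData (↥(maximalRealSubfield L)) L (IsCMField.complexConj L) 3 H).rightRegular μ k (MemLp.toLp (toQuotFun (adelicGroupData (↥(maximalRealSubfield L)) L (IsCMField.complexConj L) 3 H) fun g => Φ g j) (hΦ j)) = (MemLp.toLp (toQuotFun (adelicGroupData (↥(maximalRealSubfield L)) L (IsCMField.complexConj L) 3 H) fun g => Φ g j) (hΦ j))) ∧
        (∃ Kf : Subgroup (finAdelic (↥(maximalRealSubfield L)) L (IsCMField.complexConj L) 3 H), IsOpen (Kf : Set (finAdelic (↥(maximalRealSubfield L)) L (IsCMField.complexConj L) 3 H)) ∧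
          ∀ k ∈ Kf, ∀ j, (adelicGroupData (↥(maximalRealSubfield L)) L (IsCMField.complexConj L) 3 H).rightRegular μ (finAdelicToAdelic (↥(maximalRealSubfield L)) L (IsCMField.complexConj L) 3 H k) (MemLp.toLp (toQuotFun (adelicGroupData (↥(maximalRealSubfield L)) L (IsCMField.complexConj L) 3 H) fun g => Φ g j) (hΦ j)) = (MemLp.toLp (toQuotFun (adelicGroupData (↥(maximalRealSubfield L)) L (IsCMField.complexConj L) 3 H) fun g => Φ g j) (hΦ j))) ∧
        (∀ (k : stabilizer (↥U21) x₀) (j : Fin 2), (adelicGroupData (↥(maximalRealSubfield L)) L (IsCMField.complexConj L) 3 H).rightRegular μ (cmArchSection L ι H T hT k) (MemLp.toLp (toQuotFun (adelicGroupData (↥(maximalRealSubfield L)) L (IsCMField.complexConj L) 3 H) fun g => Φ g j) (hΦ j)) =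
          ∑ i : Fin 2, (BallForms.isPullbackCocycle_cotangentCocycle.weightOf x₀ k⁻¹ (Pi.single i 1)) j • (MemLp.toLp (toQuotFun (adelicGroupData (↥(maximalRealSubfield L)) L (IsCMField.complexConj L) 3 H) fun g => Φ g i) (hΦ i))) ∧
        (∀ j, DifferentiableAt ℝ (fun b : Fin 2 → ℂ => (adelicGroupData (↥(maximalRealSubfield L)) L (IsCMField.complexConj L) 3 H).rightRegular μ (cmArchSection L ι H T hT (BallForms.expP b)) (MemLp.toLp (toQuotFun (adelicGroupData (↥(maximalRealSubfield L)) L (IsCMField.complexConj L) 3 H) fun g => Φ g j) (hΦ j))) 0) ∧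
        (∀ j, ∀ b : Fin 2 → ℂ,
          fderiv ℝ (fun b : Fin 2 → ℂ => (adelicGroupData (↥(maximalRealSubfield L)) L (IsCMField.complexConj L) 3 H).rightRegular μ (cmArchSection L ι H T hT (BallForms.expP b)) (MemLp.toLp (toQuotFun (adelicGroupData (↥(maximalRealSubfield L)) L (IsCMField.complexConj L) 3 H) fun g => Φ g j) (hΦ j))) 0 (Complex.I • b) =
            Complex.I • fderiv ℝ (fun b : Fin 2 → ℂ => (adelicGroupData (↥(maximalRealSubfield L)) L (IsCMField.complexConj L) 3 H).rightRegular μ (cmArchSection L ι H T hT (BallForms.expP b)) (MemLp.toLp (toQuotFun (adelicGroupData (↥(maximalRealSubfield L)) L (IsCMField.complexConj L) 3 H) fun g => Φ g j) (hΦ j))) 0 b))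
    (hR : ∀ (L : Type) [Field L] [NumberField L] [IsCMField L] (ι : L →+* ℂ) (H : Matrix (Fin 3) (Fin 3) L) (T : GL (Fin 3) ℂ)
      (hT : (T : Matrix (Fin 3) (Fin 3) ℂ)ᴴ * H.map ι * (T : Matrix (Fin 3) (Fin 3) ℂ) = Literature.Geometry.ComplexHyperbolic.BallModel.J),
      (∀ τ' : L →+* ℂ, InfinitePlace.mk τ' ≠ InfinitePlace.mk ι → (H.map τ').PosDef) →
      2 ≤ Module.finrank ℚ ↥(maximalRealSubfield L) →
      ∀ (μ : Measure (adelicGroupData (↥(maximalRealSubfield L)) L (IsCMField.complexConj L) 3 H).automorphicQuotient)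
        [(adelicGroupData (↥(maximalRealSubfield L)) L (IsCMField.complexConj L) 3 H).IsAutomorphicMeasure μ]
        (ν : Measure ↥U21) [ν.IsHaarMeasure] (A : ↥U21 → Matrix (Fin 2) (Fin 2) ℂ),
        (Continuous A ∧ HasCompactSupport A ∧
          (∀ (j i : Fin 2) (u' : ↥U21), ContDiff ℝ 1 fun b : Fin 2 → ℂ => A (BallForms.expP b * u') j i) ∧
          ∀ j i : Fin 2, Continuous fun p : (Fin 2 → ℂ) × ↥U21 => fderiv ℝ (fun b : Fin 2 → ℂ => A (BallForms.expP b * p.2) j i) p.1) →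
      ∀ (w : Fin 2 → (adelicGroupData (↥(maximalRealSubfield L)) L (IsCMField.complexConj L) 3 H).L2 μ),
        (∀ j, (∑ i : Fin 2, ∫ t, A t j i • (adelicGroupData (↥(maximalRealSubfield L)) L (IsCMField.complexConj L) 3 H).rightRegular μ (cmArchSection L ι H T hT t) (w i) ∂ν) = w j) →
        (∀ k ∈ cmCompactFactor L ι H T hT, ∀ j, (adelicGroupData (↥(maximalRealSubfield L)) L (IsCMField.complexConj L) 3 H).rightRegular μ k (w j) = w j) →
        (∃ Kf : Subgroup (finAdelic (↥(maximalRealSubfield L)) L (IsCMField.complexConj L) 3 H), IsOpen (Kf : Set (finAdelic (↥(maximalRealSubfield L)) L (IsCMField.complexConj L) 3 H)) ∧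
          ∀ k ∈ Kf, ∀ j, (adelicGroupData (↥(maximalRealSubfield L)) L (IsCMField.complexConj L) 3 H).rightRegular μ (finAdelicToAdelic (↥(maximalRealSubfield L)) L (IsCMField.complexConj L) 3 H k) (w j) = w j) →
        ∃ Ψ : Fin 2 → ((adelicGroupData (↥(maximalRealSubfield L)) L (IsCMField.complexConj L) 3 H).Adelic → ℂ), ∀ j,
          (∀ γ ∈ (adelicGroupData (↥(maximalRealSubfield L)) L (IsCMField.complexConj L) 3 H).quotientSubgroup, ∀ x, Ψ j (γ * x) = Ψ j x) ∧
            Continuous (Ψ j) ∧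
            toQuotFun (adelicGroupData (↥(maximalRealSubfield L)) L (IsCMField.complexConj L) 3 H) (Ψ j) =ᵐ[μ] (w j : (adelicGroupData (↥(maximalRealSubfield L)) L (IsCMField.complexConj L) 3 H).automorphicQuotient → ℂ) ∧
            (∀ y, DifferentiableAt ℝ (fun b : Fin 2 → ℂ => Ψ j (y * cmArchSection L ι H T hT (BallForms.expP b))) 0) ∧
            (∀ b : Fin 2 → ℂ, Continuous fun y => fderiv ℝ (fun b : Fin 2 → ℂ => Ψ j (y * cmArchSection L ι H T hT (BallForms.expP b))) 0 b) ∧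
            ∀ b : Fin 2 → ℂ,
              toQuotFun (adelicGroupData (↥(maximalRealSubfield L)) L (IsCMField.complexConj L) 3 H) (fun y => fderiv ℝ (fun b : Fin 2 → ℂ => Ψ j (y * cmArchSection L ι H T hT (BallForms.expP b))) 0 b) =ᵐ[μ]
                ((fderiv ℝ (fun b : Fin 2 → ℂ => (adelicGroupData (↥(maximalRealSubfield L)) L (IsCMField.complexConj L) 3 H).rightRegular μ (cmArchSection L ι H T hT (BallForms.expP b)) (w j)) 0 b : (adelicGroupData (↥(maximalRealSubfield L)) L (IsCMField.complexConj L) 3 H).L2 μ) :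
                  (adelicGroupData (↥(maximalRealSubfield L)) L (IsCMField.complexConj L) 3 H).automorphicQuotient → ℂ))
    (hC : Literature.NumberTheory.Rogawski1990.cohFinComponent_isTheta)
    (hU4 : StubU4SignRule) (hJ3a : HJ3aType) (hocc : HoccType) :
    Summit.HodgeConjecture.HodgeConjecture.Theses.HCCMUnconditional.H413 :=
  P2H413OfSocketsCD.H413_of_sockets_CD hC (holCotFormSpectralProjection_of_SR hS hR) hU4 hJ3a hocc


/-! ## v2 — (S) discharged BY NAME: ★ `F0P2dStubSCotFormL2Data.stubSCotFormL2Data_holds` (A-p18 (g16)); census {R} -/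

/-- **(D) from (R) alone** — (K) ★ p03, (S) ★ A-p18 (its closer takes `IsRegularKernel` as FOUR hypotheses and returns the six `IsL2CotPair` clauses as a conjunction;
the glue re-brackets the kernel hypothesis, nothing else). [cite: Borel1997, Thm. 2.13 and §5.14] [cite: BorelJacquet1979, §4.2 and §4.6] -/
theorem holCotFormSpectralProjection_of_R
    (hR : ∀ (L : Type) [Field L] [NumberField L] [IsCMField L] (ι : L →+* ℂ) (H : Matrix (Fin 3) (Fin 3) L) (T : GL (Fin 3) ℂ)
      (hT : (T : Matrix (Fin 3) (Fin 3) ℂ)ᴴ * H.map ι * (T : Matrix (Fin 3) (Fin 3) ℂ) = Literature.Geometry.ComplexHyperbolic.BallModel.J),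
      (∀ τ' : L →+* ℂ, InfinitePlace.mk τ' ≠ InfinitePlace.mk ι → (H.map τ').PosDef) →
      2 ≤ Module.finrank ℚ ↥(maximalRealSubfield L) →
      ∀ (μ : Measure (adelicGroupData (↥(maximalRealSubfield L)) L (IsCMField.complexConj L) 3 H).automorphicQuotient)
        [(adelicGroupData (↥(maximalRealSubfield L)) L (IsCMField.complexConj L) 3 H).IsAutomorphicMeasure μ]
        (ν : Measure ↥U21) [ν.IsHaarMeasure] (A : ↥U21 → Matrix (Fin 2) (Fin 2) ℂ),
        (Continuous A ∧ HasCompactSupport A ∧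
          (∀ (j i : Fin 2) (u' : ↥U21), ContDiff ℝ 1 fun b : Fin 2 → ℂ => A (BallForms.expP b * u') j i) ∧
          ∀ j i : Fin 2, Continuous fun p : (Fin 2 → ℂ) × ↥U21 => fderiv ℝ (fun b : Fin 2 → ℂ => A (BallForms.expP b * p.2) j i) p.1) →
      ∀ (w : Fin 2 → (adelicGroupData (↥(maximalRealSubfield L)) L (IsCMField.complexConj L) 3 H).L2 μ),
        (∀ j, (∑ i : Fin 2, ∫ t, A t j i • (adelicGroupData (↥(maximalRealSubfield L)) L (IsCMField.complexConj L) 3 H).rightRegular μ (cmArchSection L ι H T hT t) (w i) ∂ν) = w j) →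
        (∀ k ∈ cmCompactFactor L ι H T hT, ∀ j, (adelicGroupData (↥(maximalRealSubfield L)) L (IsCMField.complexConj L) 3 H).rightRegular μ k (w j) = w j) →
        (∃ Kf : Subgroup (finAdelic (↥(maximalRealSubfield L)) L (IsCMField.complexConj L) 3 H), IsOpen (Kf : Set (finAdelic (↥(maximalRealSubfield L)) L (IsCMField.complexConj L) 3 H)) ∧
          ∀ k ∈ Kf, ∀ j, (adelicGroupData (↥(maximalRealSubfield L)) L (IsCMField.complexConj L) 3 H).rightRegular μ (finAdelicToAdelic (↥(maximalRealSubfield L)) L (IsCMField.complexConj L) 3 H k) (w j) = w j) →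
        ∃ Ψ : Fin 2 → ((adelicGroupData (↥(maximalRealSubfield L)) L (IsCMField.complexConj L) 3 H).Adelic → ℂ), ∀ j,
          (∀ γ ∈ (adelicGroupData (↥(maximalRealSubfield L)) L (IsCMField.complexConj L) 3 H).quotientSubgroup, ∀ x, Ψ j (γ * x) = Ψ j x) ∧
            Continuous (Ψ j) ∧
            toQuotFun (adelicGroupData (↥(maximalRealSubfield L)) L (IsCMField.complexConj L) 3 H) (Ψ j) =ᵐ[μ] (w j : (adelicGroupData (↥(maximalRealSubfield L)) L (IsCMField.complexConj L) 3 H).automorphicQuotient → ℂ) ∧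
            (∀ y, DifferentiableAt ℝ (fun b : Fin 2 → ℂ => Ψ j (y * cmArchSection L ι H T hT (BallForms.expP b))) 0) ∧
            (∀ b : Fin 2 → ℂ, Continuous fun y => fderiv ℝ (fun b : Fin 2 → ℂ => Ψ j (y * cmArchSection L ι H T hT (BallForms.expP b))) 0 b) ∧
            ∀ b : Fin 2 → ℂ,
              toQuotFun (adelicGroupData (↥(maximalRealSubfield L)) L (IsCMField.complexConj L) 3 H) (fun y => fderiv ℝ (fun b : Fin 2 → ℂ => Ψ j (y * cmArchSection L ι H T hT (BallForms.expP b))) 0 b) =ᵐ[μ]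
                ((fderiv ℝ (fun b : Fin 2 → ℂ => (adelicGroupData (↥(maximalRealSubfield L)) L (IsCMField.complexConj L) 3 H).rightRegular μ (cmArchSection L ι H T hT (BallForms.expP b)) (w j)) 0 b : (adelicGroupData (↥(maximalRealSubfield L)) L (IsCMField.complexConj L) 3 H).L2 μ) :
                  (adelicGroupData (↥(maximalRealSubfield L)) L (IsCMField.complexConj L) 3 H).automorphicQuotient → ℂ))
    : holCotFormSpectralProjection :=
  holCotFormSpectralProjection_of_SR
    (fun L _ _ _ ι H T hT hdef hrk μ _ ν _ A hA hrep Φ hΦm hΦ =>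
      F0P2dStubSCotFormL2Data.stubSCotFormL2Data_holds L ι H T hT hdef hrk μ ν A hA.1 hA.2.1 hA.2.2.1 hA.2.2.2 hrep Φ hΦm hΦ)
    hR

set_option synthInstance.maxHeartbeats 400000 in
set_option maxHeartbeats 8000000 in
/-- **THE CRUX BY NAME from (R), (C), U4 and the rows `hJ3a`, `hocc`** ((K), (S) ★). [cite: Liu2021, Prop. 4.13 and Rem. 4.14] [cite: Rogawski1990, Thm. 13.3.1] -/
theorem H413_of_R_CU4
    (hR : ∀ (L : Type) [Field L] [NumberField L] [IsCMField L] (ι : L →+* ℂ) (H : Matrix (Fin 3) (Fin 3) L) (T : GL (Fin 3) ℂ)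
      (hT : (T : Matrix (Fin 3) (Fin 3) ℂ)ᴴ * H.map ι * (T : Matrix (Fin 3) (Fin 3) ℂ) = Literature.Geometry.ComplexHyperbolic.BallModel.J),
      (∀ τ' : L →+* ℂ, InfinitePlace.mk τ' ≠ InfinitePlace.mk ι → (H.map τ').PosDef) →
      2 ≤ Module.finrank ℚ ↥(maximalRealSubfield L) →
      ∀ (μ : Measure (adelicGroupData (↥(maximalRealSubfield L)) L (IsCMField.complexConj L) 3 H).automorphicQuotient)
        [(adelicGroupData (↥(maximalRealSubfield L)) L (IsCMField.complexConj L) 3 H).IsAutomorphicMeasure μ]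
        (ν : Measure ↥U21) [ν.IsHaarMeasure] (A : ↥U21 → Matrix (Fin 2) (Fin 2) ℂ),
        (Continuous A ∧ HasCompactSupport A ∧
          (∀ (j i : Fin 2) (u' : ↥U21), ContDiff ℝ 1 fun b : Fin 2 → ℂ => A (BallForms.expP b * u') j i) ∧
          ∀ j i : Fin 2, Continuous fun p : (Fin 2 → ℂ) × ↥U21 => fderiv ℝ (fun b : Fin 2 → ℂ => A (BallForms.expP b * p.2) j i) p.1) →
      ∀ (w : Fin 2 → (adelicGroupData (↥(maximalRealSubfield L)) L (IsCMField.complexConj L) 3 H).L2 μ),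
        (∀ j, (∑ i : Fin 2, ∫ t, A t j i • (adelicGroupData (↥(maximalRealSubfield L)) L (IsCMField.complexConj L) 3 H).rightRegular μ (cmArchSection L ι H T hT t) (w i) ∂ν) = w j) →
        (∀ k ∈ cmCompactFactor L ι H T hT, ∀ j, (adelicGroupData (↥(maximalRealSubfield L)) L (IsCMField.complexConj L) 3 H).rightRegular μ k (w j) = w j) →
        (∃ Kf : Subgroup (finAdelic (↥(maximalRealSubfield L)) L (IsCMField.complexConj L) 3 H), IsOpen (Kf : Set (finAdelic (↥(maximalRealSubfield L)) L (IsCMField.complexConj L) 3 H)) ∧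
          ∀ k ∈ Kf, ∀ j, (adelicGroupData (↥(maximalRealSubfield L)) L (IsCMField.complexConj L) 3 H).rightRegular μ (finAdelicToAdelic (↥(maximalRealSubfield L)) L (IsCMField.complexConj L) 3 H k) (w j) = w j) →
        ∃ Ψ : Fin 2 → ((adelicGroupData (↥(maximalRealSubfield L)) L (IsCMField.complexConj L) 3 H).Adelic → ℂ), ∀ j,
          (∀ γ ∈ (adelicGroupData (↥(maximalRealSubfield L)) L (IsCMField.complexConj L) 3 H).quotientSubgroup, ∀ x, Ψ j (γ * x) = Ψ j x) ∧
            Continuous (Ψ j) ∧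
            toQuotFun (adelicGroupData (↥(maximalRealSubfield L)) L (IsCMField.complexConj L) 3 H) (Ψ j) =ᵐ[μ] (w j : (adelicGroupData (↥(maximalRealSubfield L)) L (IsCMField.complexConj L) 3 H).automorphicQuotient → ℂ) ∧
            (∀ y, DifferentiableAt ℝ (fun b : Fin 2 → ℂ => Ψ j (y * cmArchSection L ι H T hT (BallForms.expP b))) 0) ∧
            (∀ b : Fin 2 → ℂ, Continuous fun y => fderiv ℝ (fun b : Fin 2 → ℂ => Ψ j (y * cmArchSection L ι H T hT (BallForms.expP b))) 0 b) ∧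
            ∀ b : Fin 2 → ℂ,
              toQuotFun (adelicGroupData (↥(maximalRealSubfield L)) L (IsCMField.complexConj L) 3 H) (fun y => fderiv ℝ (fun b : Fin 2 → ℂ => Ψ j (y * cmArchSection L ι H T hT (BallForms.expP b))) 0 b) =ᵐ[μ]
                ((fderiv ℝ (fun b : Fin 2 → ℂ => (adelicGroupData (↥(maximalRealSubfield L)) L (IsCMField.complexConj L) 3 H).rightRegular μ (cmArchSection L ι H T hT (BallForms.expP b)) (w j)) 0 b : (adelicGroupData (↥(maximalRealSubfield L)) L (IsCMField.complexConj L) 3 H).L2 μ) :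
                  (adelicGroupData (↥(maximalRealSubfield L)) L (IsCMField.complexConj L) 3 H).automorphicQuotient → ℂ))
    (hC : Literature.NumberTheory.Rogawski1990.cohFinComponent_isTheta)
    (hU4 : StubU4SignRule) (hJ3a : HJ3aType) (hocc : HoccType) :
    Summit.HodgeConjecture.HodgeConjecture.Theses.HCCMUnconditional.H413 :=
  P2H413OfSocketsCD.H413_of_sockets_CD hC (holCotFormSpectralProjection_of_R hR) hU4 hJ3a hocc


/-! ## v3 — (R) discharged BY NAME: ★ `F0P2dStubR.stubR_holds` (F0P2-p04 (g2)); census ∅ — THE (D) SOCKET IS A THEOREM -/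

/-- **(D) `CotangentForms.holCotFormSpectralProjection` — UNCONDITIONAL, BY NAME.**  «The spectral projection `pr_P` of (the `L²` class of) a holomorphic cotangent
form on the compact unitary Shimura quotient `U(H)(L⁺)\U(H)(𝔸_{L⁺})` onto a discrete automorphic summand `P` is again (the class of) a holomorphic cotangent form.»
Proof = the (D)-desk sub-line `F0_P2SpectralProjectionD` of crux `H413` (road (h) «holomorphic reproduction», CENSUS-R v2): (K) the matrix reproducing kernel on
`U(2,1)` (p03 (g2), ★ `CotangentForms.stubK_reproducingKernel_holds`) · (S) the `L²` shadow of a holomorphic cotangent form (A-p18 (g16), ★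
`F0P2dStubSCotFormL2Data.stubSCotFormL2Data_holds`) · (H) Hilbert transport through `pr_P` (A-p06 (g18), ★ `F0P2dStubHProjectedL2Data.stubHProjectedL2Data_holds`) ·
(R) regularity of reproduced classes (F0P2-p04 (g2), ★ `F0P2dStubR.stubR_holds`; its closer takes `IsRegularKernel` as FOUR hypotheses — the glue re-brackets) · (G)
pointwise Cauchy–Riemann from the weak one (F0P2-p01 (g2), ★ `P2StubGHolGermOfWeak.isHolGerm_of_weaklyHol`) · (T) pointwise invariances from the a.e. ones (F0P2-p02 (g2), ★
`F0P2dStubT.stubT_holds`) · assembled by ★ `F0P2dSocketDOfStubs.holCotFormSpectralProjection_of_KSR` (F0P2-p01 (g2)); planned by F0P2-plan (g2), registered by A-plan1 (g18),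
refereed by F0P2-ref1 (g0).  No printed citation is a hypothesis. [cite: BorelJacquet1979, §4.6] [cite: Borel1997, Thm. 2.13, §5.14 and §8.4] [cite: HarishChandra1966, §8, Thm. 1] -/
theorem holCotFormSpectralProjection_holds : holCotFormSpectralProjection :=
  holCotFormSpectralProjection_of_R
    (fun L _ _ _ ι H T hT hdef hrk μ _ ν _ A hA w hrep hkc hkf =>
      F0P2dStubR.stubR_holds L ι H T hT hdef hrk μ ν A hA.1 hA.2.1 hA.2.2.1 hA.2.2.2 w hrep hkc hkf)

/-- **(D̄) `CotangentForms.antiholCotFormSpectralProjection` — UNCONDITIONAL, BY NAME** (complex conjugation of discrete summands, ★ p794879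
`antiholCotFormSpectralProjection_of_hol`). [cite: BorelWallach2000, VII 2.10] [cite: BorelJacquet1979, §4.6] -/
theorem antiholCotFormSpectralProjection_holds : antiholCotFormSpectralProjection :=
  antiholCotFormSpectralProjection_of_hol holCotFormSpectralProjection_holds

/-- **U2′ `StubU2CohFormsSpectrumIsThetaAt` from the engine letter (C) ALONE** ((D) discharged; ★ p796532 `P2StubU2OfLettersCD`). [cite: Liu2021, proof of Prop. 4.13]
[cite: Rogawski1990, Thm. 13.3.1] -/
theorem stubU2_cohFormsSpectrumIsThetaAt_of_C (hC : Literature.NumberTheory.Rogawski1990.cohFinComponent_isTheta) :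
    StubU2CohFormsSpectrumIsThetaAt :=
  P2StubU2OfLettersCD.stub_U2_cohFormsSpectrumIsThetaAt_of_C_D hC holCotFormSpectralProjection_holds

/-- **The floor row `hdictE` from the two engine letters (C), U4** ((D) discharged). [cite: Liu2021, proof of Prop. 4.13, l. 2145; Rem. 4.14]
[cite: GelbartRogawski1991, Introduction p. 448 L30–33; Thm 5.1.1 p. 465] -/
theorem hdictE_of_CU4 (hC : Literature.NumberTheory.Rogawski1990.cohFinComponent_isTheta) (hU4 : StubU4SignRule) : HdictEType :=
  P2H413OfSocketsCD.hdictE_of_sockets_CD hC holCotFormSpectralProjection_holds hU4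

set_option synthInstance.maxHeartbeats 400000 in
set_option maxHeartbeats 8000000 in
/-- **THE CRUX `HCCMUnconditional.H413` BY NAME FROM THE TWO ENGINE LETTERS (C) `Rogawski1990.cohFinComponent_isTheta`, U4 `StubU4SignRule` AND THE FLOOR ROWS
`hJ3a` (P3), `hocc` (P4)** — the floor-0 P2 census of record after the (D) desk: {(C), U4} ∪ rows; (C′), (D), (D̄) gone BY NAME.  HC_CM is proved only modulo the printed
citations until rung 0 closes. [cite: Liu2021, Prop. 4.13 and proof l. 2121–2146; Rem. 4.14] [cite: GelbartRogawski1991, Introduction p. 448; Thm 5.1.1]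
[cite: Rogawski1990, Thm. 13.3.1] -/
theorem H413_of_CU4 (hC : Literature.NumberTheory.Rogawski1990.cohFinComponent_isTheta) (hU4 : StubU4SignRule)
    (hJ3a : HJ3aType) (hocc : HoccType) : Summit.HodgeConjecture.HodgeConjecture.Theses.HCCMUnconditional.H413 :=
  P2H413OfSocketsCD.H413_of_sockets_CD hC holCotFormSpectralProjection_holds hU4 hJ3a hocc

end Summit.HodgeConjecture.HodgeConjecture.Cruxes.H413.F0P2dSocketD

end
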